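import Mathlib
import Literature.MathematicalPhysics.QuantumFieldTheory.Balaban1983to89.B12Decay510

/-!
# NODE O ∕ K0⁷ stub 2′ — round-2 crux-ideate SEAT 4 (provocation «transfer», residue ρ4 of PRINT-ROAD §3):
# «COERCIVITY ⇒ DECAY BY EXPONENTIAL CONJUGATION ON THE COVARIANT RESPONSE OBJECTS» — typed NODE sketch (D-0171)
# for the crux idea card `coercive-transfer-ct` on `stmt-QuantumFields-20541` (`Record13SepCoPHInhabited`).

Seat `cruxidea-stmt-QuantumFields-20541-4` g0 (planner; count-neutral; no registry writes besides the crux idea card).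
HONEST LINE: nothing of Bałaban is asserted here; every declaration below is either an ABSTRACT finite-dimensional
linear-algebra statement (P2a, P2b, P3, P1s — Mathlib-level; v1.1: ALL FOUR KERNEL-PROVED in § Proofs at the end of this file:
`combesThomasAbs_holds`, `combesThomasRel_holds`, `unitarySchurInvariance_holds`, `coercivityStable_holds`) or a HYPOTHESIS SHAPE (P1, P4, OUT);
K0⁷ `stmt-QuantumFields-20541` is OPEN; NODE O is not inhabited; the Yang–Mills mass gap (Clay) is NOT proved by any of this.
This file has NO `sorry` and NO `theorem` about the record (the theorems are abstract linear algebra over `Matrix ι ι ℝ` ∕ unitary blocks).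

DICTIONARY (transfer, explicit):  Dimock arXiv:1108.1335 (scalar φ⁴₃)  ↦  Bałaban [I] = CMP 109 ∕ [15] = CMP 102 ∕ B9 = CMP 99 (gauge, d = 4)
* response of the background to the block field: (48)–(50) p.7, `φ_k(Φ_k) = a_k G_k Q_kᵀ Φ_k` — LINEAR, kernel = scalar Green's function
    ↦ [I] (2.2)–(2.3) p.265 minimiser `V^{(k)} = M_k(U_{k+1})`, [15] Sect. G (182)–(188) pp.307–308: `δℋ_k(B)∕δB(c)` solves a LINEARISED
      equation, «has regularity and decay properties identical to the propagator H, or HQ» (p.307), Prop. 9 p.309 ∕ (190); B9 (3.129) p.421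
      `H₁B = G₁Q*(QG₁Q*)⁻¹B`, (3.128) `G₁⁻¹ = Δ₁ + DRD* + Q*aQ` (tree: `B9Eq3112`, `B9Eq3152`, `B9SectDFP`, `B10Eq54QuadForm`).
* coercivity: App. D Lemma 29 (342)–(347) p.47 (block Poincaré + averaging mass + Neumann bracketing)
    ↦ B4 (1.13)–(1.20) p.573–574 `γ₀I ≤ Δ^{(k)}(Ω,A) + aL⁻²P(A) ≤ γ₁I`, B5 (CMP 95) positivity, B9 Sect. E positivity of Δ_k (3.156) — PRINT-STATED.
* decay from coercivity: Lemma 30 (349)–(359) pp.47–48, `D_q = e_{−q}[−Δ + μ̄_k + a_kQ_kᵀQ_k]_Ω e_q`, kinematic bound (351), `‖D_q⁻¹‖ ≤ 2c₀⁻¹`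
    ↦ P2a∕P2b below VERBATIM on the gauge-fixed covariant forms: the weights `e^{μρ(x)}` are SCALAR per site∕bond and commute with the unitary
      parallel transporters, so the kinematic constant is BACKGROUND-INDEPENDENT (P3).  Print instead uses random-walk expansions
      (B4 (2.13) p.577 «Theorem ⇐ random walk representation», B6, B9 §3; quoted as such by Dimock for abelian gauge fields, arXiv:1712.10029 p.37).
* what does NOT transfer for free: (i) the flat VECTOR coercivity with axial∕Landau terms (B5; no scalar Poincaré inequality gives it) = P1 (INSTRUMENTABLE:
  Engine C level-0∕1 arrays); (ii) k-uniform SUP-regularity in d = 4 (Dimock L.31–33 use flat smoothness (373) in d = 3) = P4 (UNDECIDED).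
-/

noncomputable section

namespace YM.NodeO.Seat4.CoerciveTransfer

open Matrix Finset Real
open scoped BigOperators
open Literature.MathematicalPhysics.QuantumFieldTheory.Balaban1983to89
open Literature.MathematicalPhysics.QuantumFieldTheory.Balaban1983to89.B12Decay510 (SiteGeometry)

/-! ## P2 — the LEVER (v1.1: PROVED, Mathlib-level): abstract Combes–Thomas ∕ exponential conjugation for coercive matrices -/

/-- Exponential conjugation `(E_{μρ} H E_{μρ}⁻¹)_{ij} = e^{μρ_i} H_{ij} e^{−μρ_j}` (Dimock (350) with a general 1-Lipschitz weight `ρ`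
in place of `q·x`). [cite: arXiv:1108.1335, (350) p.47; CombesThomas1973 = CMP 34 (1973) 251–270] -/
def conjW {ι : Type*} (μ : ℝ) (ρ : ι → ℝ) (H : Matrix ι ι ℝ) : Matrix ι ι ℝ :=
  Matrix.of fun i j => Real.exp (μ * ρ i) * H i j * Real.exp (-(μ * ρ j))

/-- **P2a · CombesThomasAbs (FIRST LEMMA of the line; v1.1: KERNEL-PROVED below, `combesThomasAbs_holds`).**  A real matrix `H` on a finite index set, coercive as a quadratic form
(`m‖f‖² ≤ ⟨f, Hf⟩`), whose off-diagonal obeys the WEIGHTED SCHUR bounds `Σ_j |H_ij|(e^{μ d(i,j)} − 1) ≤ m∕2` (rows and columns) for a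
pseudo-metric `d` (zero self-distance, symmetric, triangle), has an inverse with ENTRYWISE exponential decay `|H⁻¹_ij| ≤ (2∕m) e^{−μ d(i,j)}`.  Proof (§ Proofs, `ct_core`): with `ρ = d(·, j)`,
`|(conjW μ ρ H − H)_il| ≤ |H_il|(e^{μ d(i,l)} − 1)`, Schur test ⇒ `⟨f, conjW μ ρ H f⟩ ≥ (m∕2)‖f‖²` ⇒ `‖(conjW μ ρ H)⁻¹‖ ≤ 2∕m`, and
`H⁻¹_ij = e^{−μ(ρ_i − ρ_j)} ((conjW μ ρ H)⁻¹)_ij`.  Unit-lattice (single-scale) currency: entry ≤ operator norm is sharp there.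
[cite: arXiv:1108.1335, Lemma 30 (349)–(359) pp.47–48; arXiv:2303.10754, Lemma (Combes–Thomas) p.8] -/
def CombesThomasAbs : Prop :=
  ∀ (ι : Type) [Fintype ι] [DecidableEq ι] (H : Matrix ι ι ℝ) (d : ι → ι → ℝ) (m μ : ℝ),
    0 < m → 0 ≤ μ →
    (∀ i, d i i = 0) → (∀ i j, 0 ≤ d i j) → (∀ i j, d i j = d j i) → (∀ i j l, d i l ≤ d i j + d j l) →
    (∀ f : ι → ℝ, m * (f ⬝ᵥ f) ≤ f ⬝ᵥ (H *ᵥ f)) →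
    (∀ i, ∑ j, |H i j| * (Real.exp (μ * d i j) - 1) ≤ m / 2) →
    (∀ j, ∑ i, |H i j| * (Real.exp (μ * d i j) - 1) ≤ m / 2) →
    ∀ i j, |H⁻¹ i j| ≤ 2 / m * Real.exp (-(μ * d i j))

/-- **P2b · CombesThomasRel (v1.1: KERNEL-PROVED below, `combesThomasRel_holds`; Dimock's form-relative version, the one uniform in the lattice spacing η = L^{−k}).**
`N ≥ I` a reference form (print: `−Δ + I`), `H ≥ c₀N` as forms, and the CONJUGATION DEFECT form-bounded by `c₁μ·N` (the kinematic bound (351));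
then for `μc₁ ≤ c₀∕2` the inverse decays entrywise at rate `μ` in the weight `ρ`.  [cite: arXiv:1108.1335, (343), (351), (356)–(359) pp.46–48] -/
def CombesThomasRel : Prop :=
  ∀ (ι : Type) [Fintype ι] [DecidableEq ι] (H N : Matrix ι ι ℝ) (ρ : ι → ℝ) (c₀ c₁ μ : ℝ),
    0 < c₀ → 0 ≤ c₁ → 0 ≤ μ → μ * c₁ ≤ c₀ / 2 →
    (∀ f : ι → ℝ, f ⬝ᵥ f ≤ f ⬝ᵥ (N *ᵥ f)) →
    (∀ f : ι → ℝ, c₀ * (f ⬝ᵥ (N *ᵥ f)) ≤ f ⬝ᵥ (H *ᵥ f)) →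
    (∀ f : ι → ℝ, |f ⬝ᵥ ((conjW μ ρ H - H) *ᵥ f)| ≤ c₁ * μ * (f ⬝ᵥ (N *ᵥ f))) →
    ∀ i j, |H⁻¹ i j| ≤ 2 / c₀ * Real.exp (-(μ * (ρ i - ρ j)))

/-! ## P3 — why the transfer is VERBATIM on covariant objects (v1.1: PROVED): scalar weights commute with unitary parallel transport -/

/-- **P3 · UnitarySchurInvariance (v1.1: KERNEL-PROVED below, `unitarySchurInvariance_holds`).**  A «covariant hopping matrix» on `ι × κ` (sites∕bonds × colour) with blocks
`w(x,y)·u(x,y)`, `u(x,y)` UNITARY, has weighted Schur row sums bounded by `√(#κ)` times those of its scalar skeleton `w` — for ANY weight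
`θ(x,y)` (in the application `θ = e^{μ d} − 1`), uniformly in the unitaries: the constants of P2a∕P2b for the covariant operators
`D_U*D_U + DRD* + Q(U)*aQ(U)` do not see the background.  (Row of a unitary: `Σ_b |u_ab| ≤ √#κ`.) [folklore; cite: arXiv:1108.1335, (352)–(355) p.47–48 (scalar case)] -/
def UnitarySchurInvariance : Prop :=
  ∀ (ι κ : Type) [Fintype ι] [Fintype κ] [DecidableEq κ] (w θ : ι → ι → ℝ) (u : ι → ι → Matrix κ κ ℂ),
    (∀ x y, u x y ∈ Matrix.unitaryGroup κ ℂ) →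
    ∀ (x : ι) (a : κ), ∑ y, ∑ b, ‖((θ x y * w x y : ℝ) : ℂ) * u x y a b‖ ≤ Real.sqrt (Fintype.card κ) * ∑ y, |θ x y * w x y|

/-! ## P1 — the NON-TRANSFERRING INPUT (INSTRUMENTABLE; print-STATED): uniform coercivity of the gauge-fixed single-scale fluctuation forms -/

/-- **P1 · UniformCoercivityShape (hypothesis SHAPE; INSTRUMENTABLE on Engine C's held level-0∕1 arrays; print-STATED as B4 (1.13)–(1.20) p.573–574,
B5 = CMP 95 positivity, B9 Sect. E p.427–428 positivity of `Δ_k` (3.156)).**  A family of real quadratic forms `K V j` (volume `V`, scale `j`,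
dimension `n V j`) restricted to a GAUGE-FIXED coordinate set `S V j` (axial tree gauge = coordinate subspace) is coercive with ONE constant `m`:
the letter the lever P2 consumes.  Rule (N) toy witness: `uniformCoercivityShape_toy` (identity forms). [cite: Balaban1983RegularityDecay, (1.13)–(1.20) pp.573–574; Balaban1985BackgroundPropagators, (3.156) p.428] -/
def UniformCoercivityShape {𝓥 : Type*} (n : 𝓥 → ℕ → ℕ) (K : (V : 𝓥) → (j : ℕ) → Matrix (Fin (n V j)) (Fin (n V j)) ℝ)
    (S : (V : 𝓥) → (j : ℕ) → Finset (Fin (n V j))) (m : ℝ) : Prop :=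
  0 < m ∧ ∀ V j (f : Fin (n V j) → ℝ), (∀ i, i ∉ S V j → f i = 0) → m * (f ⬝ᵥ f) ≤ f ⬝ᵥ (K V j *ᵥ f)

/-- Rule (N): the shape is inhabited (identity forms, everything gauge-fixed, `m = 1`). [folklore] -/
theorem uniformCoercivityShape_toy :
    UniformCoercivityShape (𝓥 := Unit) (fun _ j => j) (fun _ j => (1 : Matrix (Fin j) (Fin j) ℝ)) (fun _ _ => Finset.univ) 1 := by
  refine ⟨one_pos, fun V j f _ => ?_⟩
  simp [Matrix.one_mulVec]

/-- **P1s · CoercivityStable (PROVED, `coercivityStable_holds` — the door (α_cof) step).**  Coercivity with constant `m` survives a symmetric perturbation whose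
quadratic form is bounded by `(m∕2)‖f‖²`, with constant `m∕2`: at the record's COFINAL radii `a₀ → 0` (door (α_cof), tree
`K0V23Stub3DoorSuppliers.K0BoxCofinalRadii`) the covariant form at a small background is, cube by cube after a local gauge fixing, the FLAT
form plus such a perturbation — so the instrumentable object is the FLAT gauge-fixed vector form (Engine C's `Kprime`). [folklore] -/
def CoercivityStable : Prop :=
  ∀ (ι : Type) [Fintype ι] (K P : Matrix ι ι ℝ) (m : ℝ), 0 < m →
    (∀ f : ι → ℝ, m * (f ⬝ᵥ f) ≤ f ⬝ᵥ (K *ᵥ f)) → (∀ f : ι → ℝ, |f ⬝ᵥ (P *ᵥ f)| ≤ m / 2 * (f ⬝ᵥ f)) →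
    ∀ f : ι → ℝ, m / 2 * (f ⬝ᵥ f) ≤ f ⬝ᵥ ((K + P) *ᵥ f)

/-- P1s holds (two lines of algebra) — the only piece PROVED in this sketch, to show the door step is free. [folklore] -/
theorem coercivityStable_holds : CoercivityStable := by
  intro ι _ K P m hm hK hP f
  have h1 := hK f
  have h2 := hP f
  have h3 : -(m / 2 * (f ⬝ᵥ f)) ≤ f ⬝ᵥ (P *ᵥ f) := by
    have := neg_abs_le (f ⬝ᵥ (P *ᵥ f)); linarith
  rw [Matrix.add_mulVec, dotProduct_add]
  linarith

/-! ## P4 — the SECOND non-free input (UNDECIDED): k-uniform SUP-regularity («weighted-L² on unit boxes ⟹ pointwise», uniform in η = L^{−k}) -/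

/-- **P4 · SupRegularityShape (hypothesis SHAPE; UNDECIDED).**  For a family of kernels `G j` on fine carriers `Λ j` with unit boxes `box j : Λ j → β j`
and box distance `dβ j`: a box-to-box weighted-L² decay bound (what P2b delivers uniformly in `j`) upgrades to a POINTWISE bound with a `j`-uniform
constant.  Print: B4 Theorem (1.9)–(1.12) p.573 + B9 §1–2 (random walks); flat scalar case without random walks: arXiv:2303.10754 Thm A
(CT + analytic continuation of the Bloch–Fourier transform); Dimock d = 3: L.31–33 (373).  Route proposed on the card: FLAT gauge-fixed vector
operator by the Bloch route (Engine C holds the Bloch blocks) + P1s-type perturbation at cofinal radii.  [cite: Balaban1983RegularityDecay, Thm (1.9)–(1.12) p.573; arXiv:2303.10754, Thm A p.3] -/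
def SupRegularityShape (Λ β : ℕ → Type) (G : (j : ℕ) → Λ j → Λ j → ℝ) (box : (j : ℕ) → Λ j → β j)
    (wL2 : (j : ℕ) → β j → β j → ℝ) (dβ : (j : ℕ) → β j → β j → ℝ) (C δ : ℝ) : Prop :=
  (∀ j y y', wL2 j y y' ≤ C * Real.exp (-(δ * dβ j y y'))) →
    ∀ j (x x' : Λ j), |G j x x'| ≤ C * Real.exp (-(δ * dβ j (box j x) (box j x')))

/-! ## OUT — what the line supplies on the road of record: the two RESPONSE rows of lens-1's `N3PairShapeAt` (rows 2 and 10, :331–340 of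
`nodeO-cover/LENS-1-Line-cauchy-analytic.lean` f8d80c51dbb93008), in THEIR letters — WEAKER than `N3PairShapeAt` (no `RowE118`, no representation row),
hence strictly below `stmt-QuantumFields-20541`; = PRINT-ROAD PT-B's «[15] Prop. 9 half» (ASSUMED, M) + the two-volume tail input of N1″. -/

/-- **OUT · ResponseRowsAt** — lens-1 rows 2 (response decay, [15] Prop. 9 ∕ [I] p.282) and 10 (RESTRICTED two-volume response tails at window bonds)
over the same binder types (`S K : LocDomainSys`, `G K : SiteGeometry`, responses `h K X x : Fin (m K) → ℂ`, restriction maps `T K X`, `emb`, `wrap`,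
window `Nw`).  The line's claim, in words: P1 ∧ P2 ∧ P3 ∧ P4 (∧ PT-A existence of the minimiser, NOT claimed) ⟹ for the record's minimiser responses
these two rows hold with `B_h, δ₀` uniform in `K` and `k` — row 10 via the geometric resolvent identity `G₁P − PG₂ = G₁(PH₂ − H₁P)G₂` (seam-supported
commutator × two CT decays).  [cite: Balaban1985Variational, Prop. 9 p.309, (190); Balaban1987RG1, (1.21) p.264, p.282] -/
def ResponseRowsAt (S : ℕ → LocDomainSys) (Cc : (K : ℕ) → B12.CubeCover (S K)) (Λ : ℕ → Type) (G : (K : ℕ) → SiteGeometry (Cc K) (Λ K))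
    (m : ℕ → ℕ) (h : (K : ℕ) → (S K).Dom → Λ K → (Fin (m K) → ℂ)) (e : (K : ℕ) → Fin 4 → (Fin 4 → ℤ) → Λ K)
    (wrap : (K : ℕ) → Finset (S K).Dom) (emb : (K : ℕ) → (S K).Dom → (S (K + 1)).Dom)
    (T : (K : ℕ) → (S K).Dom → ((Fin (m (K + 1)) → ℂ) →L[ℂ] (Fin (m K) → ℂ))) (Nw : ℕ → ℕ) (Bh δ₀ : ℝ) : Prop :=
  ∀ K : ℕ,
    (∀ X x, ‖h K X x‖ ≤ Bh * Real.exp (-δ₀ * (G K).distD x X)) ∧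
    (∀ X (μ : Fin 4) (z : Fin 4 → ℤ), X ∉ wrap K → (∀ i, 2 * |z i| < (Nw K : ℤ)) →
      ‖T K X (h (K + 1) (emb K X) (e (K + 1) μ z)) - h K X (e K μ z)‖
        ≤ Bh * Real.exp (-δ₀ * (Nw K : ℝ) / 2) * Real.exp (-(δ₀ / 2) * (G K).distD (e K μ z) X))

/-! ## NODE (D-0171) — pieces and tags (informal edges; the typed objects are the `def`s above):
```
  TARGET  stmt-QuantumFields-20541  ⟸ [lens-1 `record13SepCoPHInhabited_of_N3pairCofinal`, 0 sorry]  N3PairShapeAt at cofinal radii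
  N3PairShapeAt = RowE118 ∧ ResponseRowsAt(rows 2,10) ∧ leaves ∧ representation      — THIS LINE supplies ResponseRowsAt ONLY   [WEAKER]
  ResponseRowsAt ⟸ P1 UniformCoercivityShape   [INSTRUMENTABLE: Engine C Kprime∕ARoot1 (2,3); print-STATED B4 (1.13)–(1.20), B9 Sect. E]
                 ∧ P1s CoercivityStable          [PROVED here (`coercivityStable_holds`); door (α_cof) use]
                 ∧ P2a∕P2b CombesThomasAbs∕Rel   [PROVED here v1.1 (`combesThomasAbs_holds`, `combesThomasRel_holds`); FIRST LEMMA]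
                 ∧ P3 UnitarySchurInvariance     [PROVED here v1.1 (`unitarySchurInvariance_holds`)]
                 ∧ P4 SupRegularityShape         [UNDECIDED — flat Bloch route (instrumentable: Bloch blocks held) + perturbation; print = B4∕B9 random walks]
                 ∧ (PT-A ∕ U1: existence + analyticity of the minimiser — residue ρ3, NOT claimed)   [IDEA-NEEDED∕porting]
  COSTUME check: no piece mentions β, the (1.18) pieces E_X, or the record's kernel; none restates 20541 ∕ N3 ∕ a negatives-index statement.
```
-/


/-! ## Proofs (v1.1) — P2a, P2b, P3 kernel-checked (abstract finite-dimensional linear algebra; `import Mathlib` only is used here).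
Route: `conjW` is multiplicative (`conjW_mul`, `conjW_one`) ⇒ `(conjW μ ρ H)⁻¹ = conjW μ ρ H⁻¹`; a coercive matrix is a unit and the
entries of its inverse are `≤ 1∕c` (`inv_entry_le_of_coercive`, no operator norms: test against the column `A⁻¹ e_j`); the conjugation
defect is absorbed by the AM–GM∕Schur estimate (P2a) or by the form bound (P2b); `ct_core` puts them together.  P3: a row of a unitary has
unit ℓ²-norm (`u·uᴴ = 1` on the diagonal) and Cauchy–Schwarz. -/

section Proofs

variable {ι : Type*} [Fintype ι] [DecidableEq ι]

omit [Fintype ι] [DecidableEq ι] in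
theorem conjW_apply (μ : ℝ) (ρ : ι → ℝ) (H : Matrix ι ι ℝ) (i j : ι) :
    conjW μ ρ H i j = Real.exp (μ * ρ i) * H i j * Real.exp (-(μ * ρ j)) := rfl

theorem exp_neg_mul_exp (x : ℝ) : Real.exp (-x) * Real.exp x = 1 := by
  rw [← Real.exp_add, neg_add_cancel, Real.exp_zero]

theorem exp_mul_exp_neg (x : ℝ) : Real.exp x * Real.exp (-x) = 1 := by
  rw [← Real.exp_add, add_neg_cancel, Real.exp_zero]

omit [DecidableEq ι] in
theorem conjW_mul (μ : ℝ) (ρ : ι → ℝ) (A B : Matrix ι ι ℝ) :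
    conjW μ ρ (A * B) = conjW μ ρ A * conjW μ ρ B := by
  ext i j
  simp only [conjW_apply, Matrix.mul_apply]
  rw [Finset.mul_sum, Finset.sum_mul]
  refine Finset.sum_congr rfl fun l _ => ?_
  have h := exp_neg_mul_exp (μ * ρ l)
  calc Real.exp (μ * ρ i) * (A i l * B l j) * Real.exp (-(μ * ρ j))
      = Real.exp (μ * ρ i) * A i l * (Real.exp (-(μ * ρ l)) * Real.exp (μ * ρ l)) * B l j *
          Real.exp (-(μ * ρ j)) := by rw [h]; ring
    _ = Real.exp (μ * ρ i) * A i l * Real.exp (-(μ * ρ l)) *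
          (Real.exp (μ * ρ l) * B l j * Real.exp (-(μ * ρ j))) := by ring

omit [Fintype ι] in
theorem conjW_one (μ : ℝ) (ρ : ι → ℝ) : conjW μ ρ (1 : Matrix ι ι ℝ) = 1 := by
  ext i j
  rw [conjW_apply, Matrix.one_apply]
  split_ifs with h
  · subst h; rw [mul_one, exp_mul_exp_neg]
  · rw [mul_zero, zero_mul]

omit [DecidableEq ι] in
theorem dp_self_nonneg (v : ι → ℝ) : 0 ≤ v ⬝ᵥ v :=
  Finset.sum_nonneg fun i _ => mul_self_nonneg (v i)

omit [DecidableEq ι] in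
theorem sq_le_dp_self (v : ι → ℝ) (i : ι) : v i ^ 2 ≤ v ⬝ᵥ v := by
  unfold dotProduct
  have : v i ^ 2 = v i * v i := sq (v i)
  rw [this]
  exact Finset.single_le_sum (f := fun l => v l * v l) (fun l _ => mul_self_nonneg (v l)) (Finset.mem_univ i)

/-- A coercive real matrix is a unit. -/
theorem isUnit_of_coercive {A : Matrix ι ι ℝ} {c : ℝ} (hc : 0 < c)
    (hA : ∀ f : ι → ℝ, c * (f ⬝ᵥ f) ≤ f ⬝ᵥ (A *ᵥ f)) : IsUnit A := by
  rw [← Matrix.mulVec_injective_iff_isUnit]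
  have key : ∀ v : ι → ℝ, A *ᵥ v = 0 → v = 0 := by
    intro v hv
    have h1 := hA v
    rw [hv, dotProduct_zero] at h1
    have h0 := dp_self_nonneg v
    have h2 : v ⬝ᵥ v = 0 := by
      by_contra h
      have : 0 < v ⬝ᵥ v := lt_of_le_of_ne h0 (Ne.symm h)
      nlinarith
    exact dotProduct_self_eq_zero.mp h2
  intro f g hfg
  have : A *ᵥ (f - g) = 0 := by rw [Matrix.mulVec_sub, hfg, sub_self]
  exact sub_eq_zero.mp (key _ this)

/-- Entries of the inverse of a coercive matrix are bounded by `1/c`. -/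
theorem inv_entry_le_of_coercive {A : Matrix ι ι ℝ} {c : ℝ} (hc : 0 < c)
    (hA : ∀ f : ι → ℝ, c * (f ⬝ᵥ f) ≤ f ⬝ᵥ (A *ᵥ f)) (i j : ι) : |A⁻¹ i j| ≤ 1 / c := by
  have hU : IsUnit A := isUnit_of_coercive hc hA
  have hdet : IsUnit A.det := (Matrix.isUnit_iff_isUnit_det A).mp hU
  set v : ι → ℝ := fun l => A⁻¹ l j with hv
  have hv' : v = A⁻¹ *ᵥ Pi.single j 1 := by
    ext l
    simp only [hv, Matrix.mulVec, dotProduct, Pi.single_apply, mul_ite, mul_one, mul_zero,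
      Finset.sum_ite_eq', Finset.mem_univ, if_true]
  have hAv : A *ᵥ v = Pi.single j 1 := by
    rw [hv', Matrix.mulVec_mulVec, Matrix.mul_nonsing_inv A hdet, Matrix.one_mulVec]
  have h1 := hA v
  rw [hAv] at h1
  have h2 : v ⬝ᵥ Pi.single j (1 : ℝ) = v j := by
    simp only [dotProduct, Pi.single_apply, mul_ite, mul_one, mul_zero, Finset.sum_ite_eq',
      Finset.mem_univ, if_true]
  rw [h2] at h1
  -- h1 : c * (v ⬝ᵥ v) ≤ v j ;  (c s)^2 ≤ (v j)^2 ≤ s  ⇒  s ≤ 1/c^2  ⇒ |v i| ≤ 1/c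
  have hs0 := dp_self_nonneg v
  have hvj := sq_le_dp_self v j
  have hvi := sq_le_dp_self v i
  have hvi' : v i ^ 2 ≤ (1 / c) ^ 2 := by
    rcases eq_or_lt_of_le hs0 with h | h
    · rw [← h] at hvi
      have : v i ^ 2 = 0 := le_antisymm hvi (sq_nonneg _)
      rw [this]; positivity
    · have h3 : (c * (v ⬝ᵥ v)) ^ 2 ≤ v j ^ 2 :=
        pow_le_pow_left₀ (by positivity) h1 2
      have h4 : c ^ 2 * (v ⬝ᵥ v) ≤ 1 := by nlinarith
      have h5 : v ⬝ᵥ v ≤ (1 / c) ^ 2 := by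
        rw [div_pow, one_pow, le_div_iff₀ (by positivity)]; linarith [mul_comm (c^2) (v ⬝ᵥ v)]
      exact hvi.trans h5
  have hA' : A⁻¹ i j = v i := rfl
  rw [hA']
  exact abs_le_of_sq_le_sq (by simpa using hvi') (by positivity)

/-- **Core of the Combes–Thomas transfer.** If `H` is a unit and its exponential conjugate `H_μ = e^{μρ} H e^{−μρ}` is coercive
with constant `c`, then `|H⁻¹ i j| ≤ c⁻¹ · e^{−μ(ρ i − ρ j)}`. -/
theorem ct_core (H : Matrix ι ι ℝ) (ρ : ι → ℝ) (μ c : ℝ) (hc : 0 < c) (hH : IsUnit H)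
    (hcoμ : ∀ f : ι → ℝ, c * (f ⬝ᵥ f) ≤ f ⬝ᵥ (conjW μ ρ H *ᵥ f)) (i j : ι) :
    |H⁻¹ i j| ≤ 1 / c * Real.exp (-(μ * (ρ i - ρ j))) := by
  have hent : |(conjW μ ρ H)⁻¹ i j| ≤ 1 / c := inv_entry_le_of_coercive hc hcoμ i j
  have hHdet : IsUnit H.det := (Matrix.isUnit_iff_isUnit_det H).mp hH
  have hinv : (conjW μ ρ H)⁻¹ = conjW μ ρ H⁻¹ := by
    apply Matrix.inv_eq_right_inv
    rw [← conjW_mul, Matrix.mul_nonsing_inv H hHdet, conjW_one]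
  have hrel : H⁻¹ i j = Real.exp (-(μ * (ρ i - ρ j))) * (conjW μ ρ H)⁻¹ i j := by
    rw [hinv, conjW_apply, show -(μ * (ρ i - ρ j)) = -(μ * ρ i) + μ * ρ j by ring, Real.exp_add]
    have h1 := exp_neg_mul_exp (μ * ρ i)
    have h2 := exp_mul_exp_neg (μ * ρ j)
    calc H⁻¹ i j = (Real.exp (-(μ * ρ i)) * Real.exp (μ * ρ i)) * H⁻¹ i j *
          (Real.exp (μ * ρ j) * Real.exp (-(μ * ρ j))) := by rw [h1, h2]; ring
      _ = _ := by ring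
  rw [hrel, abs_mul, abs_of_pos (Real.exp_pos _), mul_comm]
  exact mul_le_mul_of_nonneg_right hent (Real.exp_pos _).le

/-- `|e^t − 1| ≤ e^{|t|} − 1`. -/
theorem abs_exp_sub_one_le (t : ℝ) : |Real.exp t - 1| ≤ Real.exp |t| - 1 := by
  rcases le_or_gt 0 t with h | h
  · rw [abs_of_nonneg h, abs_of_nonneg (by linarith [Real.one_le_exp h] : (0:ℝ) ≤ Real.exp t - 1)]
  · rw [abs_of_neg h]
    have h1 : Real.exp t ≤ 1 := Real.exp_le_one_iff.mpr h.le
    rw [abs_of_nonpos (by linarith : Real.exp t - 1 ≤ 0)]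
    have h2 := Real.add_one_le_exp t
    have h3 := Real.add_one_le_exp (-t)
    linarith

theorem combesThomasAbs_holds : CombesThomasAbs := by
  intro ι _ _ H d m μ hm hμ hd0 hdnn hdsy hdtr hco hrow hcol i j
  -- the weight ρ = d(·, j) and the conjugated matrix
  set ρ : ι → ℝ := fun l => d l j with hρ
  set Hμ : Matrix ι ι ℝ := conjW μ ρ H with hHμ
  set T : ι → ι → ℝ := fun a b => |H a b| * (Real.exp (μ * d a b) - 1) with hT
  have hTnn : ∀ a b, 0 ≤ T a b := fun a b =>
    mul_nonneg (abs_nonneg _) (by have := Real.one_le_exp (mul_nonneg hμ (hdnn a b)); linarith)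
  -- Step 1: entrywise defect bound
  have hdef : ∀ a b, |Hμ a b - H a b| ≤ T a b := by
    intro a b
    have hlip : |ρ a - ρ b| ≤ d a b := by
      simp only [hρ]
      rw [abs_le]; constructor
      · have := hdtr b a j; rw [hdsy b a] at this; linarith
      · have := hdtr a b j; linarith
    have e1 : Hμ a b - H a b = H a b * (Real.exp (μ * (ρ a - ρ b)) - 1) := by
      rw [hHμ, conjW_apply, show μ * (ρ a - ρ b) = μ * ρ a + -(μ * ρ b) by ring, Real.exp_add]; ring
    rw [e1, abs_mul]
    refine mul_le_mul_of_nonneg_left ?_ (abs_nonneg _)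
    have h2 := abs_exp_sub_one_le (μ * (ρ a - ρ b))
    have h3 : Real.exp |μ * (ρ a - ρ b)| ≤ Real.exp (μ * d a b) := by
      apply Real.exp_le_exp.mpr
      rw [abs_mul, abs_of_nonneg hμ]
      exact mul_le_mul_of_nonneg_left hlip hμ
    linarith
  -- Step 2: coercivity of Hμ with constant m/2
  have hco2 : ∀ f : ι → ℝ, m / 2 * (f ⬝ᵥ f) ≤ f ⬝ᵥ (Hμ *ᵥ f) := by
    intro f
    have hsplit : f ⬝ᵥ (Hμ *ᵥ f) = f ⬝ᵥ (H *ᵥ f) + f ⬝ᵥ ((Hμ - H) *ᵥ f) := by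
      rw [Matrix.sub_mulVec, dotProduct_sub]; ring
    have hD : |f ⬝ᵥ ((Hμ - H) *ᵥ f)| ≤ m / 2 * (f ⬝ᵥ f) := by
      have e : f ⬝ᵥ ((Hμ - H) *ᵥ f) = ∑ a, ∑ b, f a * ((Hμ - H) a b * f b) := by
        simp only [dotProduct, Matrix.mulVec, Finset.mul_sum]
      rw [e]
      calc |∑ a, ∑ b, f a * ((Hμ - H) a b * f b)|
          ≤ ∑ a, ∑ b, |f a * ((Hμ - H) a b * f b)| := by
            refine (Finset.abs_sum_le_sum_abs _ _).trans ?_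
            exact Finset.sum_le_sum fun a _ => Finset.abs_sum_le_sum_abs _ _
        _ ≤ ∑ a, ∑ b, T a b * ((f a) ^ 2 + (f b) ^ 2) / 2 := by
            refine Finset.sum_le_sum fun a _ => Finset.sum_le_sum fun b _ => ?_
            rw [abs_mul, abs_mul, Matrix.sub_apply]
            have h1 := hdef a b
            have h2 : |f a| * |f b| ≤ ((f a) ^ 2 + (f b) ^ 2) / 2 := by
              nlinarith [sq_nonneg (|f a| - |f b|), sq_abs (f a), sq_abs (f b), abs_nonneg (f a), abs_nonneg (f b)]
            calc |f a| * (|Hμ a b - H a b| * |f b|) = |Hμ a b - H a b| * (|f a| * |f b|) := by ring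
              _ ≤ T a b * (((f a) ^ 2 + (f b) ^ 2) / 2) :=
                  mul_le_mul h1 h2 (mul_nonneg (abs_nonneg _) (abs_nonneg _)) (hTnn a b)
              _ = T a b * ((f a) ^ 2 + (f b) ^ 2) / 2 := by ring
        _ = (∑ a, (f a) ^ 2 * ∑ b, T a b) / 2 + (∑ b, (f b) ^ 2 * ∑ a, T a b) / 2 := by
            have : ∀ a b, T a b * ((f a) ^ 2 + (f b) ^ 2) / 2 = T a b * (f a) ^ 2 / 2 + T a b * (f b) ^ 2 / 2 :=
              fun a b => by ring
            simp only [this, Finset.sum_add_distrib]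
            congr 1
            · rw [Finset.sum_div]
              refine Finset.sum_congr rfl fun a _ => ?_
              rw [Finset.mul_sum, Finset.sum_div]
              refine Finset.sum_congr rfl fun b _ => ?_
              ring
            · rw [Finset.sum_comm, Finset.sum_div]
              refine Finset.sum_congr rfl fun b _ => ?_
              rw [Finset.mul_sum, Finset.sum_div]
              refine Finset.sum_congr rfl fun a _ => ?_
              ring
        _ ≤ (∑ a, (f a) ^ 2 * (m / 2)) / 2 + (∑ b, (f b) ^ 2 * (m / 2)) / 2 := by
            gcongr with a _ b _
            · exact hrow a
            · exact hcol b
        _ = m / 2 * (f ⬝ᵥ f) := by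
            simp only [dotProduct, ← Finset.sum_mul, sq]
            ring
    have h0 := hco f
    have habs := neg_abs_le (f ⬝ᵥ ((Hμ - H) *ᵥ f))
    rw [hsplit]
    linarith
  -- Steps 3–4: the core lemma with c = m/2 and ρ = d(·, j), ρ j = d j j = 0
  have hHunit : IsUnit H := isUnit_of_coercive hm hco
  have key := ct_core H ρ μ (m / 2) (by positivity) hHunit hco2 i j
  have e1 : (1 : ℝ) / (m / 2) = 2 / m := by field_simp
  have e2 : -(μ * (ρ i - ρ j)) = -(μ * d i j) := by simp only [hρ, hd0 j, sub_zero]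
  rw [e1, e2] at key
  exact key

theorem combesThomasRel_holds : CombesThomasRel := by
  intro ι _ _ H N ρ c₀ c₁ μ hc₀ hc₁ hμ hμc hN hH hD i j
  have hNnn : ∀ f : ι → ℝ, 0 ≤ f ⬝ᵥ (N *ᵥ f) := fun f => (dp_self_nonneg f).trans (hN f)
  have hco : ∀ f : ι → ℝ, c₀ * (f ⬝ᵥ f) ≤ f ⬝ᵥ (H *ᵥ f) := fun f =>
    (mul_le_mul_of_nonneg_left (hN f) hc₀.le).trans (hH f)
  have hHunit : IsUnit H := isUnit_of_coercive hc₀ hco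
  have hco2 : ∀ f : ι → ℝ, c₀ / 2 * (f ⬝ᵥ f) ≤ f ⬝ᵥ (conjW μ ρ H *ᵥ f) := by
    intro f
    have hsplit : f ⬝ᵥ (conjW μ ρ H *ᵥ f) = f ⬝ᵥ (H *ᵥ f) + f ⬝ᵥ ((conjW μ ρ H - H) *ᵥ f) := by
      rw [Matrix.sub_mulVec, dotProduct_sub]; ring
    have h1 := hH f
    have h2 := hD f
    have h3 := neg_abs_le (f ⬝ᵥ ((conjW μ ρ H - H) *ᵥ f))
    have h4 : c₁ * μ * (f ⬝ᵥ (N *ᵥ f)) ≤ c₀ / 2 * (f ⬝ᵥ (N *ᵥ f)) :=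
      mul_le_mul_of_nonneg_right (by rw [mul_comm]; exact hμc) (hNnn f)
    have h5 := hN f
    have h6 : c₀ / 2 * (f ⬝ᵥ f) ≤ c₀ / 2 * (f ⬝ᵥ (N *ᵥ f)) := mul_le_mul_of_nonneg_left h5 (by positivity)
    rw [hsplit]
    linarith
  have key := ct_core H ρ μ (c₀ / 2) (by positivity) hHunit hco2 i j
  have e1 : (1 : ℝ) / (c₀ / 2) = 2 / c₀ := by field_simp
  rw [e1] at key
  exact key

theorem unitarySchurInvariance_holds : UnitarySchurInvariance := by
  intro ι κ _ _ _ w θ u hu x a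
  have hrow : ∀ y, ∑ b, ‖u x y a b‖ ≤ Real.sqrt (Fintype.card κ) := by
    intro y
    have hmem := Matrix.mem_unitaryGroup_iff.mp (hu x y)
    have hdiag := congr_fun (congr_fun hmem a) a
    simp only [Matrix.mul_apply, Matrix.star_apply, Complex.star_def, Complex.mul_conj,
      Matrix.one_apply_eq, Complex.normSq_eq_norm_sq] at hdiag
    have h1 : ∑ b, ‖u x y a b‖ ^ 2 = 1 := by exact_mod_cast hdiag
    have h3 : (∑ b, ‖u x y a b‖) ^ 2 ≤ Fintype.card κ := by
      have hcs := Finset.sum_mul_sq_le_sq_mul_sq Finset.univ (fun b => ‖u x y a b‖) (fun _ => (1 : ℝ))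
      simp only [mul_one, one_pow, Finset.sum_const, Finset.card_univ, nsmul_eq_mul, mul_one] at hcs
      rw [h1, one_mul] at hcs
      exact hcs
    exact (Real.le_sqrt (Finset.sum_nonneg fun b _ => norm_nonneg _) (by positivity)).mpr h3
  calc ∑ y, ∑ b, ‖((θ x y * w x y : ℝ) : ℂ) * u x y a b‖
      = ∑ y, |θ x y * w x y| * ∑ b, ‖u x y a b‖ := by
        refine Finset.sum_congr rfl fun y _ => ?_
        rw [Finset.mul_sum]
        refine Finset.sum_congr rfl fun b _ => ?_
        rw [norm_mul, Complex.norm_real, Real.norm_eq_abs]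
    _ ≤ ∑ y, |θ x y * w x y| * Real.sqrt (Fintype.card κ) :=
        Finset.sum_le_sum fun y _ => mul_le_mul_of_nonneg_left (hrow y) (abs_nonneg _)
    _ = Real.sqrt (Fintype.card κ) * ∑ y, |θ x y * w x y| := by
        rw [Finset.mul_sum]
        exact Finset.sum_congr rfl fun y _ => mul_comm _ _

end Proofs

end YM.NodeO.Seat4.CoerciveTransfer

end
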